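import Summits.CriticalPhenomena.CardyFormulaZ2.Theorems.CardyIKTransportIKLinearTransportScreeningOffsetMul
import Summits.CriticalPhenomena.CardyFormulaZ2.Theorems.CardyIKTransportIKLinearTransportScreeningMasterMul
import Summits.CriticalPhenomena.CardyFormulaZ2.Theorems.CardyIKTransportIKLinearTransportRatioMix

/-!
# `stub_RatioMix` PROVED (crux stmt-CriticalPhenomena-5076 `CardyIKTransport.IKLinearTransport`, line
# `pinned-diagram-exchange`, skeleton v13/v14): density-form ratio mixing at all aspect ratios

Theorem-only support file (`--supports stmt-CriticalPhenomena-5076`; proves the registered skeleton stub `stub_RatioMix`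
BY NAME and signature). Composition (lead c3) of the three landed sub-goals of wave 1 of seat c3:
* `ScreeningAssembly.screeningOffsetMul` (p130428) — XOR-ing the box data of the internal plaquette array with an additive
  pattern multiplies the expectation of a nonnegative statistic by at most `((1+θ^n)/(1-θ^n))^(w+h)`;
* `ScreeningAssembly.screening_master_mul` (p130394) — the screening inequality for synthetic statistics in DENSITY form
  (product-form array estimate `screeningArrayExact` p124139 + multiplicative endgame `abs_integral_sub_mul_le_mul` p128820);
* `ratioMix_of_masterMul` (p130455) — the event level (pull-back along the anchored shear, error analysis via
  `sigmaExact_small` p124254).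

STATEMENT: for every aspect bound `k` and `η > 0` there is `N` such that for all `n ≥ N`, every column pattern `S`, every
`w × h` box with `w, h ≤ k n`, every measurable `E` determined by the cells at sup-distance `> n` from the box and every
measurable `L` determined by the box, `|ν_S(E ∩ L) − ν_S(E) ν_S(L)| ≤ η ν_S(E) ν_S(L)` (`RatioMixBound η S n a b w h E L`) —
Manolescu's ratio mixing property (arXiv:2502.08394 Prop. 5.9) for the column-mixed Izergin–Korepin gauge, WITHOUT FKG.
-/

noncomputable section

namespace Summit.CriticalPhenomena.CardyFormulaZ2.Theorems.IKLinearTransport.PinnedDiagramExchange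

open MeasureTheory

/-- **DENSITY-FORM RATIO MIXING AT ALL ASPECT RATIOS** (registered skeleton stub `stub_RatioMix`, v13): for every
aspect bound `k` and `η > 0` there is `N` such that for `n ≥ N`, every pattern `S`, every `w × h` box with `w, h ≤ k n`,
every measurable far event `E` (determined at sup-distance `> n` from the box) and every measurable box event `L`,
`|ν_S(E ∩ L) − ν_S(E) ν_S(L)| ≤ η ν_S(E) ν_S(L)`. Composition of the landed sub-goals `screeningOffsetMul`,
`screening_master_mul`, `ratioMix_of_masterMul`. [folklore] -/
theorem stub_RatioMix :
    ∀ (k : ℕ) (η : ℝ), 0 < η → ∃ N : ℕ, ∀ (S : Set ℤ) (n : ℕ), N ≤ n → ∀ (a b : ℤ) (w h : ℕ),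
      w ≤ k * n → h ≤ k * n → ∀ E L : Set Obs, MeasurableSet E → MeasurableSet L →
      RatioMixBound η S n a b w h E L :=
  ratioMix_of_masterMul ScreeningAssembly.screeningOffsetMul ScreeningAssembly.screening_master_mul

end Summit.CriticalPhenomena.CardyFormulaZ2.Theorems.IKLinearTransport.PinnedDiagramExchange

end
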